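import Literature.MathematicalPhysics.QuantumFieldTheory.Balaban1983to89.B8Eq178AveragesRec
import Literature.MathematicalPhysics.QuantumFieldTheory.Balaban1983to89.B8Eq119TwistedAxialRec
import Literature.MathematicalPhysics.QuantumFieldTheory.Balaban1983to89.B8Thm4TruncationLocal

/-!
# `Balaban1983to89.B8Thm4TruncationLocalRec` — RECORD TWIN of `B8Thm4TruncationLocal` §1 ([Balaban1985RegularSpaces] proof of Theorem 4, p. 88: the INDUCTIVE
# truncation «(1.29) for the truncated datum is (1.68)», and the base «u₁ = 1») + the NAMED (1.29) forms of `B8Eq178AveragesRec`, for the SYMMETRISED CENTRED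
# block averaging (0.4) of [Balaban1987RG1]

statement-level skeleton of published theorems with citation tags; proofs where landed; nothing here is a claim about the Yang–Mills mass gap

T. Bałaban, *Spaces of regular gauge field configurations on a lattice and gauge fixing conditions*, Commun. Math. Phys. **99** (1985) 75–102
`[Balaban1985RegularSpaces]` ("[6]"): (1.29) p. 81, (1.68) p. 88, p. 89 («we take Λ_{k−1} ∪ B(Λ_k) as Λ_{k−1}», «if we take u₁ = 1»), (1.78)–(1.79) p. 90;
T. Bałaban, *Averaging operations for lattice gauge theories*, Commun. Math. Phys. **98** (1985) 17–51 `[Balaban1985Averaging]` ("[3]"): (78)–(80) p. 30;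
T. Bałaban, *Renormalization group approach to lattice gauge field theories. I*, Commun. Math. Phys. **109** (1987) 249–301 `[Balaban1987RG1]` ("[I]"): (0.3)–(0.4)
pp. 252–253, pp. 253–254.  STATUS: published, refereed.

CITATION HEADER (lean-in-tree rule).  Cell `pub-ymgap`, base `pub-ymgap-dag-n05-c` g26 — N05-REC stage 2 (director-ym №254∕№255), item R5, LEAD PEN dag-n05-e
g35 (inventory `N05-REC-INVENTORY.md` e50db04501ab292d §R5 rows `B8Thm4TruncationLocal`: A `restr129_truncate_iff_cond168 restr129_one` · B `under_one_of_mem_blockSites`,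
and `B8Eq178Averages`: `restr129_iff_uavg restr129_of_cond168`).  WHAT IS REPRODUCED = under the cell's TOKEN RULE, over n05-d's record twin `Restr129Z` of
`B8Eq119TwistedAxial.Restr129` ((1.29) = `Rbar (zdBlockingZ d L) (bgTZ L U₀) j u = 1` on `Λ_j`, `j ≤ k`): §0 the NAMED (1.29) corollaries of
`B8Eq178AveragesRec`'s body-form lemmas (`restr129Z_iff_uavgZ`, `restr129Z_of_cond168Z`, `restr129Z_mul_iff_cond178Z`, `restr129Z_mul_iff_cond179Z`); §1 the engine
module ✓`B8Thm4TruncationLocal` §1's `restr129_truncate_iff_cond168`, `restr129_one`, `cond168_one` with `Restr129 ∕ Cond168 ∕ blockSites ↦ Restr129Z ∕ Cond168Z ∕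
blockSitesZ` (proofs verbatim).  NOT twinned here: the engine's §1 `under_one_of_mem_blockSites ∕ mem_blockSites_of_under_one ∕ inAx_truncate` and §2 (towers) — they rest on
the CENTRED cube towers of R4 (n05-d); §3 `base_datum` and `inAk_truncate ∕ pdevOn_*` are structure-free, REUSED BY NAME.  Kind «kernel-checked proof», theorems
only; no `instance`, no `notation`, no existing module modified.  `--supports stmt-QuantumFields-20541` (K0⁷-keyed, COUNT-NEUTRAL).

HONEST SCOPE: pure logic over the (1.29)∕(1.68) windows; NO inequality of [3]∕[6]∕[I]; `HThm4Rec` UNDISCHARGED; caveat (C-S3-1) stands; N05 [B8] DISCHARGED OF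
RECORD untouched; COUNT 7∕28 (7∕27 excl. NODE O) · K 1∕4 UNMOVED; one finite `𝕋⁴` programme at fixed `ε`, Bałaban AS PRINTED; nothing continuum ∕ ℝ⁴ ∕ OS ∕
mass-gap ∕ Clay.  No `sorry`, no `def`.

[cite: Balaban1985RegularSpaces, (1.29) p.81, (1.68) p.88, p.89, (1.78)–(1.79) p.90; Balaban1985Averaging, (78)–(80) p.30; Balaban1987RG1, (0.3)–(0.4) pp.252–253]
-/

noncomputable section

open NormedSpace

namespace Literature.MathematicalPhysics.QuantumFieldTheory.Balaban1983to89.B8Thm4TruncationLocalRec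

open B7Prop1Explicit B7Prop2Explicit
open B7Eq78Linearization (Rbar)
open B7SectCDGaugeAveragesRec (uavgZ)
open B7SectEFLinearisationRec (blockSitesZ zdBlockingZ bgTZ)
open B8Eq178AveragesRec (Cond168Z Cond178Z Cond179Z util178Z rbarZ_restr_iff_uavgZ rbarZ_restr_of_cond168Z rbarZ_restr_mul_iff_cond178Z
  rbarZ_restr_mul_iff_cond179Z rbarZ_restr_one rbar_bgTZ_succ_eq_one_of_block)
open B8Eq119TwistedAxialRec (Restr129Z)

-- `Site` alone could resolve to the torus sites of `Setup.lean`; re-export the `ℤ^d` sites of `B7Prop1Explicit`.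
export B7Prop1Explicit (Site)

variable {d : ℕ}

section Named

variable {𝔸 : Type*} [NormedRing 𝔸] [NormedAlgebra ℂ 𝔸] [CompleteSpace 𝔸]

/-! ## §0 The NAMED (1.29) forms (record twin `Restr129Z`) of `B8Eq178AveragesRec`'s lemmas -/

/-- (1.29) for the record structure in the averages: `Restr129Z L k Λ U₀ u ↔ ∀ j ≤ k, ∀ y ∈ Λ_j, uavgZ L U₀ u j y = 1` (twin of
`B8Eq178Averages.restr129_iff_uavg`). [cite: Balaban1985RegularSpaces, (1.29) p.81; Balaban1985Averaging, (79)–(80) p.30] -/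
theorem restr129Z_iff_uavgZ (L k : ℕ) (Λ : ℕ → Set (Site d)) (U₀ : Site d → Fin d → 𝔸ˣ) (u : Site d → 𝔸ˣ) :
    Restr129Z L k Λ U₀ u ↔ ∀ j, j ≤ k → ∀ y ∈ Λ j, uavgZ L U₀ u j y = 1 :=
  rbarZ_restr_iff_uavgZ L k Λ U₀ u

/-- **p. 90: «hence `u₁` satisfies the conditions (1.29)»**, record structure (twin of `B8Eq178Averages.restr129_of_cond168`): (1.68) ⇒ (1.29) with `k + 1` levels,
for `L ≥ 1`. [cite: Balaban1985RegularSpaces, p.90 (sentence before (1.78)), (1.68) p.88, (1.29) p.81] -/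
theorem restr129Z_of_cond168Z {L : ℕ} (hL : 1 ≤ L) {k : ℕ} {Λ : ℕ → Set (Site d)} {U₀ : Site d → Fin d → 𝔸ˣ}
    {u₁ : Site d → 𝔸ˣ} (h : Cond168Z L k Λ U₀ u₁) : Restr129Z L (k + 1) Λ U₀ u₁ :=
  rbarZ_restr_of_cond168Z hL h

/-- **p. 90: «`u₁` satisfies (1.29) and we may write these conditions for `u′u₁` as (1.78)»**, record structure (twin of
`B8Eq178Averages.restr129_mul_iff_cond178`). [cite: Balaban1985RegularSpaces, (1.78) p.90, (1.29) p.81] -/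
theorem restr129Z_mul_iff_cond178Z {L k : ℕ} {Λ : ℕ → Set (Site d)} {U₀ : Site d → Fin d → 𝔸ˣ} {u₁ : Site d → 𝔸ˣ}
    (h₁ : Restr129Z L k Λ U₀ u₁) (u' : Site d → 𝔸ˣ) :
    Restr129Z L k Λ U₀ (u' * u₁) ↔ Cond178Z L k Λ U₀ u' u₁ :=
  rbarZ_restr_mul_iff_cond178Z h₁ u'

/-- **p. 90, the whole sentence**, record structure (twin of `B8Eq178Averages.restr129_mul_iff_cond179`): if `u₁` satisfies (1.29) and `ũ′ʲ` stays in the domain of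
the logarithm on `𝔅_k`, then «`u′u₁` satisfies (1.29)» ⇔ (1.79). [cite: Balaban1985RegularSpaces, (1.78)–(1.79) p.90, (1.29) p.81] -/
theorem restr129Z_mul_iff_cond179Z {L k : ℕ} {Λ : ℕ → Set (Site d)} {U₀ : Site d → Fin d → 𝔸ˣ} {u₁ : Site d → 𝔸ˣ}
    (h₁ : Restr129Z L k Λ U₀ u₁) {u' : Site d → 𝔸ˣ}
    (hdom : ∀ j, j ≤ k → ∀ y ∈ Λ j, ‖util178Z L U₀ u' u₁ j y - 1‖ < 1) :
    Restr129Z L k Λ U₀ (u' * u₁) ↔ Cond179Z L k Λ U₀ u' u₁ :=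
  rbarZ_restr_mul_iff_cond179Z h₁ hdom

/-! ## §1 The truncated datum: its (1.29) is (1.68); the base `u₁ = 1` (record structure) -/

variable {L k : ℕ} {Λ Λ' : ℕ → Set (Site d)}

/-- **(1.29) FOR THE TRUNCATED DATUM IS (1.68), record structure** (twin of `restr129_truncate_iff_cond168`): for every gauge transformation `u`,
`Restr129Z L k Λ′ U₀ u` (the level-`k` theorem's gauge condition on `Λ′`, `Λ′_k = Λ_k ∪ B(Λ_{k+1})` with the CENTRED blocks `blockSitesZ`) ⟺ `Cond168Z L k Λ U₀ u`.
[cite: Balaban1985RegularSpaces, (1.68) p.88, (1.29) p.81, p.89 ("we take Λ_{k−1} ∪ B(Λ_k) as Λ_{k−1}")] -/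
theorem restr129Z_truncate_iff_cond168Z (hlt : ∀ j, j < k → Λ' j = Λ j)
    (hk : ∀ x, x ∈ Λ' k ↔ x ∈ Λ k ∨ ∃ y ∈ Λ (k + 1), x ∈ blockSitesZ L y)
    (U₀ : Site d → Fin d → 𝔸ˣ) (u : Site d → 𝔸ˣ) : Restr129Z L k Λ' U₀ u ↔ Cond168Z L k Λ U₀ u := by
  constructor
  · intro h
    refine ⟨fun j hj y hy => ?_, fun y hy => ?_, fun y hy x hx => ?_⟩
    · exact h j hj.le y (by rw [hlt j hj]; exact hy)
    · exact h k le_rfl y ((hk y).2 (Or.inl hy))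
    · exact h k le_rfl x ((hk x).2 (Or.inr ⟨y, hy, hx⟩))
  · rintro ⟨h1, h2, h3⟩ j hj y hy
    rcases Nat.lt_or_ge j k with hjk | hjk
    · exact h1 j hjk y (by rw [← hlt j hjk]; exact hy)
    · obtain rfl : j = k := le_antisymm hj hjk
      rcases (hk y).1 hy with hy' | ⟨w, hw, hyw⟩
      · exact h2 y hy'
      · exact h3 w hw y hyw

/-- `u₁ = 1` satisfies (1.29) at every level, record structure (twin of `restr129_one`; the generic `Rbar_one`) — the base «if we take u₁ = 1».
[cite: Balaban1985RegularSpaces, p.89 ("if we take u₁ = 1")] -/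
theorem restr129Z_one (L k : ℕ) (Λ : ℕ → Set (Site d)) (U₀ : Site d → Fin d → 𝔸ˣ) :
    Restr129Z L k Λ U₀ (1 : Site d → 𝔸ˣ) :=
  rbarZ_restr_one L k Λ U₀

/-- `u₁ = 1` satisfies (1.68), record structure (twin of `cond168_one`; through `restr129Z_truncate_iff_cond168Z` with the truncation `Λ′` displayed).
[cite: Balaban1985RegularSpaces, p.89 ("if we take u₁ = 1"), (1.68) p.88] -/
theorem cond168Z_one (L k : ℕ) (Λ : ℕ → Set (Site d)) (U₀ : Site d → Fin d → 𝔸ˣ) :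
    Cond168Z L k Λ U₀ (1 : Site d → 𝔸ˣ) := by
  have h := restr129Z_one L k (fun j => if j < k then Λ j else {x | x ∈ Λ k ∨ ∃ y ∈ Λ (k + 1), x ∈ blockSitesZ L y}) U₀
  exact (restr129Z_truncate_iff_cond168Z (Λ := Λ) (fun j hj => by simp [hj]) (fun x => by simp) U₀ 1).1 h

end Named

end Literature.MathematicalPhysics.QuantumFieldTheory.Balaban1983to89.B8Thm4TruncationLocalRec

end
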